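import Summits.Schanuel.Schanuel.Theorems.DiophantineDichotomyDefs
import Summits.Schanuel.Schanuel.Theorems.DiophantineDichotomyKhovanskiiApproxTypeSiegelInIdeal
import Summits.Schanuel.Schanuel.Theorems.DiophantineDichotomyKhovanskiiApproxTypeTransferOfSiegel

/-!
# `stub_penaltyTransfer` — the codimension-one transfer in the Ably penalty class

Route `DiophantineDichotomy`, crux `KhovanskiiApproxType` (stmt-Schanuel-6116), line
`height-window-compactness`, registered stub `stub_penaltyTransfer : CodimOneTransferX` (all objects
from `Summits.Schanuel.Schanuel.Theorems.DiophantineDichotomyDefs`, namespace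
`…KhovanskiiApproxType.HeightWindowCompactness`).

The statement: a codimension-one measure `(μ, κ, C)` at `ω ∈ ℂᵐ` in the Ably penalty class
(`log|P(ω)| ≥ −(C D^μ log H(P) + exp(κ Dᵐ log(D+2)))`, `D = max 1 (deg P)`) gives a primitive
approximation measure with degree exponent `p = (μ+1)/m` in the class `exp(κ' d log(d+2))`:
`‖γ − ω‖ ≥ exp(−(C' d^p (log H + d)/d' + exp(κ' d log(d+2))))` for every algebraic challenger `γ`.

The proof is a re-run of the landed `stub_transferOfSiegel : SiegelInIdeal → CodimOneTransfer`
(`DiophantineDichotomyKhovanskiiApproxTypeTransferOfSiegel.lean`), with the relative Siegel lemma now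
supplied unconditionally by the landed `stub_siegelInIdeal` (shape `(A, B, E)`): for a challenger `γ`
(`F = ℚ(γ)`, `[F:ℚ] ≤ d`) take the degree parameter `t` of `exists_degree_param`
(`A(d+1) ≤ (t+1)ᵐ`, `t ≤ c₁ d^{1/m}`), the Siegel relation `Q ≠ 0` on the box `[0,t]ᵐ` (`Q(γ) = 0`,
`H(Q) ≤ B(t+1)^E exp(E t Σ h(γⱼ))`), bound `|Q(ω)|` from below by the codimension-one measure at `Q`
and from above by the mean value estimate `norm_aeval_sub_aeval_le`, and do the exponent bookkeeping
with the landed `exists_transferConst` at `K = 0`.  The only new ingredient is the PENALTY ABSORPTION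
(sub-namespace `PenaltyTransfer`): `Δ = max 1 (deg Q) ≤ m(t+1) ≤ c₂ d^{1/m}`, so
`Δᵐ ≤ c₂ᵐ d`, `log(Δ+2) ≤ (log(c₂+1)/log 3 + 1) log(d+2)`, hence
`exp(κ Δᵐ log(Δ+2)) ≤ exp(κ₁ d log(d+2))`; the polynomial loss `C' d^q` of the bookkeeping is
`≤ exp((C'/log 3 + q) d log(d+2))`; and `eˣ + eʸ ≤ exp(x + y + 1) ≤ exp((κ₁ + κ₂ + 1/log 3) d log(d+2))`
(`d log(d+2) ≥ log 3`).
-/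

noncomputable section

-- `Summit.Schanuel.Schanuel.…` is the mandated summit/sub-problem namespace (single-conjunct summit), hence:
set_option linter.dupNamespace false

namespace Summit.Schanuel.Schanuel.Cruxes.KhovanskiiApproxType.HeightWindowCompactness

open Summit.Schanuel.Schanuel.Cruxes.KhovanskiiApproxType.LwSmallHeight
open Literature.NumberTheory.Transcendental (weilHeight₁ weilHeight₁_nonneg)
open Polynomial

namespace PenaltyTransfer

/-! ## Penalty absorption (pure real analysis) -/

/-- `log 3 ≤ d log(d+2)` for `d ≥ 1`. -/
theorem log_three_le_mul_log {d : ℝ} (hd : 1 ≤ d) : Real.log 3 ≤ d * Real.log (d + 2) := by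
  have h1 : Real.log 3 ≤ Real.log (d + 2) := Real.log_le_log (by norm_num) (by linarith)
  have h2 : 0 ≤ Real.log (d + 2) := Real.log_nonneg (by linarith)
  calc Real.log 3 ≤ Real.log (d + 2) := h1
    _ = 1 * Real.log (d + 2) := (one_mul _).symm
    _ ≤ d * Real.log (d + 2) := mul_le_mul_of_nonneg_right hd h2

/-- THE PENALTY EXPONENT OF THE AUXILIARY RELATION: if `1 ≤ Δ ≤ c₂ d^{1/m}` (`d ≥ 1`, `m ≥ 1`,
`c₂ ≥ 0`) then `κ Δᵐ log(Δ+2) ≤ κ⁺ c₂ᵐ (log(c₂+1)/log 3 + 1) · d log(d+2)`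
(`Δᵐ ≤ c₂ᵐ d`, `Δ + 2 ≤ (c₂+1)(d+2)`, `log(c₂+1) ≤ (log(c₂+1)/log 3) log(d+2)`). -/
theorem penalty_exponent_le {m : ℕ} (hm : 1 ≤ m) {κ c₂ d Δ : ℝ} (hc₂ : 0 ≤ c₂) (hd : 1 ≤ d)
    (hΔ1 : 1 ≤ Δ) (hΔ : Δ ≤ c₂ * d ^ (1 / m : ℝ)) :
    κ * Δ ^ m * Real.log (Δ + 2) ≤
      max κ 0 * c₂ ^ m * (Real.log (c₂ + 1) / Real.log 3 + 1) * (d * Real.log (d + 2)) := by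
  have hd0 : 0 < d := by linarith
  have hΔ0 : 0 ≤ Δ := by linarith
  have hm0 : m ≠ 0 := by omega
  -- `Δ^m ≤ c₂^m d`
  have hΔm : Δ ^ m ≤ c₂ ^ m * d := by
    calc Δ ^ m ≤ (c₂ * d ^ (1 / m : ℝ)) ^ m := pow_le_pow_left₀ hΔ0 hΔ m
      _ = c₂ ^ m * d := by rw [mul_pow, one_div, Real.rpow_inv_natCast_pow hd0.le hm0]
  -- `Δ ≤ c₂ d`
  have hδd : d ^ (1 / m : ℝ) ≤ d := by
    calc d ^ (1 / m : ℝ) ≤ d ^ (1 : ℝ) := by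
          refine Real.rpow_le_rpow_of_exponent_le hd ?_
          rw [one_div]
          exact inv_le_one_of_one_le₀ (by exact_mod_cast hm)
      _ = d := Real.rpow_one d
  have hΔd : Δ ≤ c₂ * d := hΔ.trans (mul_le_mul_of_nonneg_left hδd hc₂)
  -- `log(Δ+2) ≤ (log(c₂+1)/log 3 + 1) log(d+2)`
  have h3 : 0 < Real.log 3 := Real.log_pos (by norm_num)
  have hL2 : Real.log 3 ≤ Real.log (d + 2) := Real.log_le_log (by norm_num) (by linarith)
  have hL0 : 0 ≤ Real.log (d + 2) := h3.le.trans hL2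
  have hlogc : 0 ≤ Real.log (c₂ + 1) := Real.log_nonneg (by linarith)
  have hlogΔ : Real.log (Δ + 2) ≤ (Real.log (c₂ + 1) / Real.log 3 + 1) * Real.log (d + 2) := by
    have h1 : Δ + 2 ≤ (c₂ + 1) * (d + 2) := by nlinarith
    have h2 : Real.log (Δ + 2) ≤ Real.log (c₂ + 1) + Real.log (d + 2) := by
      rw [← Real.log_mul (by positivity) (by positivity)]
      exact Real.log_le_log (by linarith) h1
    have h4 : Real.log (c₂ + 1) ≤ Real.log (c₂ + 1) / Real.log 3 * Real.log (d + 2) := by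
      calc Real.log (c₂ + 1) = Real.log (c₂ + 1) / Real.log 3 * Real.log 3 := by
            rw [div_mul_cancel₀ _ h3.ne']
        _ ≤ Real.log (c₂ + 1) / Real.log 3 * Real.log (d + 2) :=
            mul_le_mul_of_nonneg_left hL2 (div_nonneg hlogc h3.le)
    calc Real.log (Δ + 2) ≤ Real.log (c₂ + 1) + Real.log (d + 2) := h2
      _ ≤ Real.log (c₂ + 1) / Real.log 3 * Real.log (d + 2) + Real.log (d + 2) := by linarith
      _ = (Real.log (c₂ + 1) / Real.log 3 + 1) * Real.log (d + 2) := by ring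
  -- combine
  have hlogΔ0 : 0 ≤ Real.log (Δ + 2) := Real.log_nonneg (by linarith)
  have ha0 : 0 ≤ Real.log (c₂ + 1) / Real.log 3 + 1 := add_nonneg (div_nonneg hlogc h3.le) zero_le_one
  have hprod : Δ ^ m * Real.log (Δ + 2) ≤
      (c₂ ^ m * d) * ((Real.log (c₂ + 1) / Real.log 3 + 1) * Real.log (d + 2)) :=
    mul_le_mul hΔm hlogΔ hlogΔ0 (mul_nonneg (pow_nonneg hc₂ m) hd0.le)
  have hP0 : 0 ≤ Δ ^ m * Real.log (Δ + 2) := mul_nonneg (pow_nonneg hΔ0 m) hlogΔ0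
  have hκ : κ ≤ max κ 0 := le_max_left _ _
  have hκ0 : 0 ≤ max κ 0 := le_max_right _ _
  calc κ * Δ ^ m * Real.log (Δ + 2) = κ * (Δ ^ m * Real.log (Δ + 2)) := by ring
    _ ≤ max κ 0 * (Δ ^ m * Real.log (Δ + 2)) := mul_le_mul_of_nonneg_right hκ hP0
    _ ≤ max κ 0 * ((c₂ ^ m * d) * ((Real.log (c₂ + 1) / Real.log 3 + 1) * Real.log (d + 2))) :=
        mul_le_mul_of_nonneg_left hprod hκ0
    _ = _ := by ring

/-- THE POLYNOMIAL LOSS IS IN THE CLASS: `C' d^q ≤ exp((C'/log 3 + q) d log(d+2))` for `C' > 0`,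
`q ≥ 0`, `d ≥ 1` (`C' ≤ e^{C'}`, `C' ≤ (C'/log 3) d log(d+2)`, `d^q = e^{q log d}`,
`log d ≤ d log(d+2)`). -/
theorem const_mul_rpow_le_exp {C' q d : ℝ} (hC' : 0 < C') (hq : 0 ≤ q) (hd : 1 ≤ d) :
    C' * d ^ q ≤ Real.exp ((C' / Real.log 3 + q) * (d * Real.log (d + 2))) := by
  have hd0 : 0 < d := by linarith
  have h3 : 0 < Real.log 3 := Real.log_pos (by norm_num)
  have hu : Real.log 3 ≤ d * Real.log (d + 2) := log_three_le_mul_log hd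
  have hL0 : 0 ≤ Real.log (d + 2) := Real.log_nonneg (by linarith)
  -- `C' ≤ exp(C'/log 3 · d log(d+2))`
  have h1 : C' ≤ Real.exp (C' / Real.log 3 * (d * Real.log (d + 2))) := by
    calc C' ≤ C' + 1 := by linarith
      _ ≤ Real.exp C' := Real.add_one_le_exp C'
      _ ≤ _ := by
          rw [Real.exp_le_exp]
          calc C' = C' / Real.log 3 * Real.log 3 := by rw [div_mul_cancel₀ _ h3.ne']
            _ ≤ C' / Real.log 3 * (d * Real.log (d + 2)) :=
                mul_le_mul_of_nonneg_left hu (div_nonneg hC'.le h3.le)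
  -- `d^q ≤ exp(q · d log(d+2))`
  have h2 : d ^ q ≤ Real.exp (q * (d * Real.log (d + 2))) := by
    rw [Real.rpow_def_of_pos hd0, Real.exp_le_exp]
    have hlogd : Real.log d ≤ Real.log (d + 2) := Real.log_le_log hd0 (by linarith)
    have hlogd2 : Real.log (d + 2) ≤ d * Real.log (d + 2) := by
      calc Real.log (d + 2) = 1 * Real.log (d + 2) := (one_mul _).symm
        _ ≤ d * Real.log (d + 2) := mul_le_mul_of_nonneg_right hd hL0
    calc Real.log d * q ≤ (d * Real.log (d + 2)) * q :=
          mul_le_mul_of_nonneg_right (hlogd.trans hlogd2) hq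
      _ = q * (d * Real.log (d + 2)) := mul_comm _ _
  calc C' * d ^ q ≤ Real.exp (C' / Real.log 3 * (d * Real.log (d + 2))) *
        Real.exp (q * (d * Real.log (d + 2))) :=
        mul_le_mul h1 h2 (Real.rpow_nonneg hd0.le q) (Real.exp_pos _).le
    _ = _ := by rw [← Real.exp_add]; congr 1; ring

/-- TWO EXPONENTIALS IN THE CLASS ADD UP IN THE CLASS: for `a, b, u ≥ 0`, `u ≥ log 3`,
`exp(a u) + exp(b u) ≤ 2 exp((a+b) u) ≤ exp((a + b + 1/log 3) u)`. -/
theorem exp_add_exp_le {a b u : ℝ} (ha : 0 ≤ a) (hb : 0 ≤ b) (hu0 : 0 ≤ u) (hu : Real.log 3 ≤ u) :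
    Real.exp (a * u) + Real.exp (b * u) ≤ Real.exp ((a + b + 1 / Real.log 3) * u) := by
  have h3 : 0 < Real.log 3 := Real.log_pos (by norm_num)
  have hau : 0 ≤ a * u := mul_nonneg ha hu0
  have hbu : 0 ≤ b * u := mul_nonneg hb hu0
  have h1 : Real.exp (a * u) ≤ Real.exp ((a + b) * u) := Real.exp_le_exp.2 (by nlinarith)
  have h2 : Real.exp (b * u) ≤ Real.exp ((a + b) * u) := Real.exp_le_exp.2 (by nlinarith)
  have h4 : (2 : ℝ) ≤ Real.exp (1 / Real.log 3 * u) := by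
    have h5 : (1 : ℝ) ≤ 1 / Real.log 3 * u := by
      calc (1 : ℝ) = 1 / Real.log 3 * Real.log 3 := (one_div_mul_cancel h3.ne').symm
        _ ≤ 1 / Real.log 3 * u := mul_le_mul_of_nonneg_left hu (div_nonneg zero_le_one h3.le)
    calc (2 : ℝ) = 1 + 1 := by norm_num
      _ ≤ Real.exp 1 := Real.add_one_le_exp 1
      _ ≤ Real.exp (1 / Real.log 3 * u) := Real.exp_le_exp.2 h5
  calc Real.exp (a * u) + Real.exp (b * u) ≤ 2 * Real.exp ((a + b) * u) := by linarith
    _ ≤ Real.exp (1 / Real.log 3 * u) * Real.exp ((a + b) * u) :=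
        mul_le_mul_of_nonneg_right h4 (Real.exp_pos _).le
    _ = Real.exp ((a + b + 1 / Real.log 3) * u) := by rw [← Real.exp_add]; congr 1; ring

/-- PENALTY ABSORPTION: with `Δ` as in `penalty_exponent_le` and `C' > 0`, `q ≥ 0`, the penalty of
the auxiliary relation plus the polynomial loss is ONE exponential of the class:
`exp(κ Δᵐ log(Δ+2)) + C' d^q ≤ exp(κ' d log(d+2))`,
`κ' = κ⁺ c₂ᵐ (log(c₂+1)/log 3 + 1) + (C'/log 3 + q) + 1/log 3`. -/
theorem penalty_absorb {m : ℕ} (hm : 1 ≤ m) {κ c₂ d Δ C' q : ℝ} (hc₂ : 0 ≤ c₂) (hd : 1 ≤ d)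
    (hΔ1 : 1 ≤ Δ) (hΔ : Δ ≤ c₂ * d ^ (1 / m : ℝ)) (hC' : 0 < C') (hq : 0 ≤ q) :
    Real.exp (κ * Δ ^ m * Real.log (Δ + 2)) + C' * d ^ q ≤
      Real.exp ((max κ 0 * c₂ ^ m * (Real.log (c₂ + 1) / Real.log 3 + 1) + (C' / Real.log 3 + q) +
        1 / Real.log 3) * d * Real.log (d + 2)) := by
  have h3 : 0 < Real.log 3 := Real.log_pos (by norm_num)
  have hlc : 0 ≤ Real.log (c₂ + 1) := Real.log_nonneg (by linarith)
  have hκ0 : 0 ≤ max κ 0 := le_max_right _ _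
  have ha0 : 0 ≤ max κ 0 * c₂ ^ m * (Real.log (c₂ + 1) / Real.log 3 + 1) :=
    mul_nonneg (mul_nonneg hκ0 (pow_nonneg hc₂ m)) (add_nonneg (div_nonneg hlc h3.le) zero_le_one)
  have hb0 : 0 ≤ C' / Real.log 3 + q := add_nonneg (div_nonneg hC'.le h3.le) hq
  have hL0 : 0 ≤ Real.log (d + 2) := Real.log_nonneg (by linarith)
  have hu0 : 0 ≤ d * Real.log (d + 2) := mul_nonneg (by linarith) hL0
  have hu : Real.log 3 ≤ d * Real.log (d + 2) := log_three_le_mul_log hd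
  have h1 := Real.exp_le_exp.2 (penalty_exponent_le (κ := κ) hm hc₂ hd hΔ1 hΔ)
  have h2 := const_mul_rpow_le_exp hC' hq hd
  rw [mul_assoc _ d]
  exact (add_le_add h1 h2).trans (exp_add_exp_le ha0 hb0 hu0 hu)

end PenaltyTransfer

/-! ## The transfer in the penalty class -/

open Summit.Schanuel.Schanuel.Cruxes.KhovanskiiApproxType.LwSmallHeight.TransferOfSiegel PenaltyTransfer in
/-- `stub_penaltyTransfer` (registered stub of line `height-window-compactness`, crux
stmt-Schanuel-6116): the CODIMENSION-ONE TRANSFER IN THE ABLY PENALTY CLASS — a codimension-one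
measure `(μ, κ, C)` at `ω ∈ ℂᵐ` (`m ≥ 1`, `μ ≥ 0`) gives a primitive approximation measure with
degree exponent `p = (μ+1)/m` and penalty `exp(κ' d log(d+2))` at `ω`.  The relative Siegel lemma is
the landed `stub_siegelInIdeal`; the bookkeeping is the landed `exists_transferConst` at `K = 0`
followed by `penalty_absorb`. -/
theorem stub_penaltyTransfer : CodimOneTransferX := by
  intro m ω μ κ C hm hμ hCM
  obtain ⟨hCpos, hC⟩ := hCM
  obtain ⟨A, B, E, hA, hB, hE, hShape⟩ := stub_siegelInIdeal m hm
  -- the constants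
  set R : ℝ := ‖ω‖ + 2 with hR
  set B₁ : ℝ := max 1 B
  set c₁ : ℝ := (2 * A) ^ (1 / m : ℝ) with hc₁
  have hR1 : 1 ≤ R := by rw [hR]; linarith [norm_nonneg ω]
  have hR0 : 0 < R := by linarith
  have hB₁1 : 1 ≤ B₁ := le_max_left _ _
  have hB₁0 : 0 < B₁ := by linarith
  have hLB : 0 ≤ Real.log B₁ := Real.log_nonneg hB₁1
  have hLR : 0 ≤ Real.log R := Real.log_nonneg hR1
  have hc₁0 : 0 ≤ c₁ := Real.rpow_nonneg (by positivity) _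
  have hm1 : (1 : ℝ) ≤ m := by exact_mod_cast hm
  have hc₂0 : 0 ≤ (m : ℝ) * (c₁ + 1) := by positivity
  have hq0 : 0 ≤ (max μ 0 + 1) / m + 1 := by
    have : 0 ≤ max μ 0 := le_max_right _ _
    positivity
  obtain ⟨C', hC'pos, hbook⟩ := exists_transferConst (K := 0) hm hμ le_rfl hCpos.le hE hLB hLR hc₁0
  refine ⟨max κ 0 * ((m : ℝ) * (c₁ + 1)) ^ m * (Real.log ((m : ℝ) * (c₁ + 1) + 1) / Real.log 3 + 1) +
    (C' / Real.log 3 + ((max μ 0 + 1) / m + 1)) + 1 / Real.log 3, C', hC'pos, ?_⟩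
  intro d d' H γ hd' hD hmin hpoly
  -- basic facts: `1 ≤ d`, `1 ≤ H`
  obtain ⟨P₀, hP₀0, hP₀deg, hP₀H, hP₀γ⟩ := hpoly ⟨0, hm⟩
  have hd : 1 ≤ d := le_trans (natDegree_pos_of_aeval_root hP₀0 hP₀γ fun x hx => by
      rwa [algebraMap_int_eq, eq_intCast, Int.cast_eq_zero] at hx) hP₀deg
  have hH : 1 ≤ H := one_le_of_coeff_le P₀ hP₀0 H hP₀H
  have hd1 : (1 : ℝ) ≤ d := by exact_mod_cast hd
  have hd'1 : (1 : ℝ) ≤ d' := by exact_mod_cast hd'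
  have hH1 : (1 : ℝ) ≤ H := by exact_mod_cast hH
  have hL0 : 0 ≤ Real.log H := Real.log_nonneg hH1
  -- WLOG `‖γ - ω‖ ≤ 1`
  by_cases hfar : 1 < ‖γ - ω‖
  · refine le_trans ?_ hfar.le
    rw [Real.exp_le_one_iff, neg_nonpos]
    refine add_nonneg ?_ (Real.exp_pos _).le
    exact div_nonneg (mul_nonneg (mul_nonneg hC'pos.le (Real.rpow_nonneg (by positivity) _))
      (by positivity)) (by positivity)
  have hnear : ‖γ - ω‖ ≤ 1 := not_lt.1 hfar
  -- the field `F = ℚ(γ)` is a number field containing the slots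
  set F : IntermediateField ℚ ℂ := IntermediateField.adjoin ℚ (Set.range γ)
  have halg : ∀ i, IsAlgebraic ℚ (γ i) := fun i => by
    obtain ⟨P, hP0, -, -, hPγ⟩ := hpoly i
    refine ⟨P.map (Int.castRingHom ℚ),
      (Polynomial.map_ne_zero_iff (Int.castRingHom ℚ).injective_int).2 hP0, ?_⟩
    rw [← algebraMap_int_eq, aeval_map_algebraMap]; exact hPγ
  haveI hFfin : FiniteDimensional ℚ F := by
    refine IntermediateField.finiteDimensional_adjoin fun x hx => ?_
    obtain ⟨i, rfl⟩ := hx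
    exact (halg i).isIntegral
  have hγF : ∀ j, γ j ∈ F := fun j => IntermediateField.subset_adjoin ℚ _ ⟨j, rfl⟩
  -- the degree parameter `t` and the auxiliary polynomial `Q`
  obtain ⟨t, ht, htc⟩ := exists_degree_param A hA m hm d hd
  have htc' : (t : ℝ) ≤ c₁ * (d : ℝ) ^ (1 / m : ℝ) := by rw [hc₁]; exact htc
  have hAt : A * ((Module.finrank ℚ F : ℝ) + 1) ≤ ((t : ℝ) + 1) ^ m := by
    refine le_trans ?_ ht
    have : (Module.finrank ℚ F : ℝ) ≤ d := by exact_mod_cast hD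
    gcongr
  obtain ⟨Q, hQ0, hbox, hQγ, hHQ⟩ := hShape F γ hγF t hAt
  -- the heights of the slots
  set S : ℝ := ∑ j, weilHeight₁ F (fun _ : Unit => γ j)
  have hS0 : 0 ≤ S := Finset.sum_nonneg fun j _ => weilHeight₁_nonneg F _
  have hS : S ≤ m * ((Real.log H + d) / d') := by
    have hj : ∀ j, weilHeight₁ F (fun _ : Unit => γ j) ≤ (Real.log H + d) / d' := fun j => by
      obtain ⟨P, hP0, hPdeg, hPH, hPγ⟩ := hpoly j
      exact weilHeight₁_slot_le F (hγF j) d d' H hd' (hmin j) P hP0 hPdeg hPH hPγ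
    calc S = ∑ j, weilHeight₁ F (fun _ : Unit => γ j) := rfl
      _ ≤ ∑ _j : Fin m, (Real.log H + d) / d' := Finset.sum_le_sum fun j _ => hj j
      _ = m * ((Real.log H + d) / d') := by
          rw [Finset.sum_const, Finset.card_univ, Fintype.card_fin, nsmul_eq_mul]
  -- the lower bound: the codimension-one measure at `Q`
  set Δ : ℝ := max 1 (Q.totalDegree : ℝ)
  set LH : ℝ := Real.log (max 1 (mvNatHeight Q : ℝ))
  have hlow : Real.exp (-(C * Δ ^ μ * LH + Real.exp (κ * Δ ^ m * Real.log (Δ + 2)))) ≤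
      ‖MvPolynomial.aeval ω Q‖ := hC Q hQ0
  have ht0 : (0 : ℝ) ≤ t := Nat.cast_nonneg _
  have hΔ1 : 1 ≤ Δ := le_max_left _ _
  have hΔ : Δ ≤ m * (t + 1) := by
    refine max_le ?_ ?_
    · calc (1 : ℝ) ≤ t + 1 := by linarith
        _ ≤ m * (t + 1) := le_mul_of_one_le_left (by linarith) hm1
    · have h' : (Q.totalDegree : ℝ) ≤ (m : ℝ) * t := by
        exact_mod_cast totalDegree_le_of_box Q hbox
      refine h'.trans (mul_le_mul_of_nonneg_left (by linarith) (by linarith))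
  -- the naive height of `Q`
  have hexpS : 0 ≤ E * t + E * t * S := by positivity
  have hHQ' : (mvNatHeight Q : ℝ) ≤ B₁ * Real.exp (E * t + E * t * S) := by
    refine hHQ.trans ?_
    have h1 : ((t : ℝ) + 1) ^ E ≤ Real.exp (E * t) := by
      calc ((t : ℝ) + 1) ^ E ≤ (Real.exp t) ^ E :=
            Real.rpow_le_rpow (by positivity) (by linarith [Real.add_one_le_exp (t : ℝ)]) hE
        _ = Real.exp (E * t) := by rw [← Real.exp_mul, mul_comm]
    have h2 : B ≤ B₁ := le_max_right _ _
    calc B * ((t : ℝ) + 1) ^ E * Real.exp (E * t * S)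
        ≤ B₁ * Real.exp (E * t) * Real.exp (E * t * S) := by
          apply mul_le_mul_of_nonneg_right _ (Real.exp_pos _).le
          exact mul_le_mul h2 h1 (Real.rpow_nonneg (by positivity) _) hB₁0.le
      _ = B₁ * Real.exp (E * t + E * t * S) := by rw [Real.exp_add]; ring
  have hH₁ : max 1 (mvNatHeight Q : ℝ) ≤ B₁ * Real.exp (E * t + E * t * S) := by
    refine max_le ?_ hHQ'
    calc (1 : ℝ) = 1 * 1 := by ring
      _ ≤ B₁ * Real.exp (E * t + E * t * S) :=
          mul_le_mul hB₁1 (Real.one_le_exp hexpS) zero_le_one hB₁0.le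
  have hLH0 : 0 ≤ LH := Real.log_nonneg (le_max_left _ _)
  have hLH : LH ≤ Real.log B₁ + E * t + E * t * S := by
    have := Real.log_le_log (by positivity) hH₁
    rw [Real.log_mul hB₁0.ne' (Real.exp_pos _).ne', Real.log_exp] at this
    linarith
  -- the bookkeeping (landed, at `K = 0`) and the penalty absorption
  have hbook := hbook hd1 hd'1 hL0 htc' hΔ1 hΔ hLH0 hLH hS0 hS
  rw [Real.rpow_zero] at hbook
  have hδ1 : (1 : ℝ) ≤ (d : ℝ) ^ (1 / m : ℝ) := Real.one_le_rpow hd1 (by positivity)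
  have hΔc : Δ ≤ (m : ℝ) * (c₁ + 1) * (d : ℝ) ^ (1 / m : ℝ) := by
    calc Δ ≤ m * (t + 1) := hΔ
      _ ≤ m * (c₁ * (d : ℝ) ^ (1 / m : ℝ) + (d : ℝ) ^ (1 / m : ℝ)) := by gcongr
      _ = (m : ℝ) * (c₁ + 1) * (d : ℝ) ^ (1 / m : ℝ) := by ring
  have habs := penalty_absorb (κ := κ) hm hc₂0 hd1 hΔ1 hΔc hC'pos hq0
  have e1 : C' * ((d : ℝ) ^ ((μ + 1) / m) * (Real.log H + d) / d') =
      C' * (d : ℝ) ^ ((μ + 1) / m) * (Real.log H + d) / d' := by ring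
  have htot : C * Δ ^ μ * LH + Real.exp (κ * Δ ^ m * Real.log (Δ + 2)) + Real.log B₁ +
      (2 * m * t + E * t + E * t * S + m * t * Real.log R) ≤
      C' * (d : ℝ) ^ ((μ + 1) / m) * (Real.log H + d) / d' +
        Real.exp ((max κ 0 * ((m : ℝ) * (c₁ + 1)) ^ m *
          (Real.log ((m : ℝ) * (c₁ + 1) + 1) / Real.log 3 + 1) +
          (C' / Real.log 3 + ((max μ 0 + 1) / m + 1)) + 1 / Real.log 3) * d * Real.log ((d : ℝ) + 2)) := by
    linarith [hbook, habs, e1, hCpos]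
  refine le_trans (Real.exp_le_exp.2 (neg_le_neg htot)) ?_
  -- the upper bound: the mean value estimate between `γ` and `ω`
  have hωR : ∀ i, ‖ω i‖ ≤ R := fun i => (norm_le_pi_norm ω i).trans (by rw [hR]; linarith)
  have hγR : ∀ i, ‖γ i‖ ≤ R := fun i => by
    have h1 : ‖γ i - ω i‖ ≤ ‖γ - ω‖ := by
      have := norm_le_pi_norm (γ - ω) i
      rwa [Pi.sub_apply] at this
    calc ‖γ i‖ = ‖(γ i - ω i) + ω i‖ := by rw [sub_add_cancel]
      _ ≤ ‖γ i - ω i‖ + ‖ω i‖ := norm_add_le _ _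
      _ ≤ 1 + ‖ω‖ := add_le_add (h1.trans hnear) (norm_le_pi_norm ω i)
      _ ≤ R := by rw [hR]; linarith
  have hup := norm_aeval_sub_aeval_le Q hbox ω γ R hR1 hωR hγR
  rw [hQγ, sub_zero] at hup
  have hN : (Q.support.card : ℝ) ≤ Real.exp (m * t) := by
    have h1 : (Q.support.card : ℝ) ≤ ((t : ℝ) + 1) ^ m := by
      exact_mod_cast card_support_le_of_box Q hbox
    refine h1.trans ?_
    calc ((t : ℝ) + 1) ^ m ≤ (Real.exp t) ^ m :=
          pow_le_pow_left₀ (by positivity) (by linarith [Real.add_one_le_exp (t : ℝ)]) m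
      _ = Real.exp (m * t) := (Real.exp_nat_mul _ _).symm
  have hmt : ((m * t : ℕ) : ℝ) ≤ Real.exp (m * t) := by
    push_cast; linarith [Real.add_one_le_exp ((m : ℝ) * t)]
  have hRmt : R ^ (m * t) = Real.exp ((m : ℝ) * t * Real.log R) := by
    rw [show (m : ℝ) * t * Real.log R = ((m * t : ℕ) : ℝ) * Real.log R by push_cast; ring,
      Real.exp_nat_mul, Real.exp_log hR0]
  have hfac : (Q.support.card : ℝ) * ((mvNatHeight Q : ℝ) * (((m * t : ℕ) : ℝ) * R ^ (m * t))) ≤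
      B₁ * Real.exp (2 * m * t + E * t + E * t * S + m * t * Real.log R) := by
    calc (Q.support.card : ℝ) * ((mvNatHeight Q : ℝ) * (((m * t : ℕ) : ℝ) * R ^ (m * t)))
        ≤ Real.exp (m * t) * ((B₁ * Real.exp (E * t + E * t * S)) *
            (Real.exp (m * t) * R ^ (m * t))) := by gcongr
      _ = B₁ * Real.exp (2 * m * t + E * t + E * t * S + m * t * Real.log R) := by
          rw [hRmt]
          have e : (2 : ℝ) * m * t + E * t + E * t * S + m * t * Real.log R =
              m * t + (E * t + E * t * S) + m * t + m * t * Real.log R := by ring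
          rw [e]; simp only [Real.exp_add]; ring
  have hup' : ‖MvPolynomial.aeval ω Q‖ ≤
      B₁ * Real.exp (2 * m * t + E * t + E * t * S + m * t * Real.log R) * ‖γ - ω‖ := by
    calc ‖MvPolynomial.aeval ω Q‖ ≤ _ := hup
      _ = (Q.support.card : ℝ) * ((mvNatHeight Q : ℝ) * (((m * t : ℕ) : ℝ) * R ^ (m * t))) *
            ‖ω - γ‖ := by ring
      _ ≤ B₁ * Real.exp (2 * m * t + E * t + E * t * S + m * t * Real.log R) * ‖ω - γ‖ :=
          mul_le_mul_of_nonneg_right hfac (norm_nonneg _)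
      _ = _ := by rw [norm_sub_rev]
  -- conclusion
  have hBU : 0 < B₁ * Real.exp (2 * m * t + E * t + E * t * S + m * t * Real.log R) := by positivity
  refine le_of_mul_le_mul_right ?_ hBU
  calc Real.exp (-(C * Δ ^ μ * LH + Real.exp (κ * Δ ^ m * Real.log (Δ + 2)) + Real.log B₁ +
          (2 * m * t + E * t + E * t * S + m * t * Real.log R))) *
        (B₁ * Real.exp (2 * m * t + E * t + E * t * S + m * t * Real.log R))
      = Real.exp (-(C * Δ ^ μ * LH + Real.exp (κ * Δ ^ m * Real.log (Δ + 2)))) := by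
        rw [show B₁ * Real.exp (2 * m * t + E * t + E * t * S + m * t * Real.log R) =
            Real.exp (Real.log B₁ + (2 * m * t + E * t + E * t * S + m * t * Real.log R)) by
              rw [Real.exp_add (Real.log B₁), Real.exp_log hB₁0], ← Real.exp_add]
        congr 1; ring
    _ ≤ ‖MvPolynomial.aeval ω Q‖ := hlow
    _ ≤ B₁ * Real.exp (2 * m * t + E * t + E * t * S + m * t * Real.log R) * ‖γ - ω‖ := hup'
    _ = ‖γ - ω‖ * (B₁ * Real.exp (2 * m * t + E * t + E * t * S + m * t * Real.log R)) := by ring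

end Summit.Schanuel.Schanuel.Cruxes.KhovanskiiApproxType.HeightWindowCompactness

end
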